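import Mathlib
import Literature.RingTheory.LocalCohomology.CechFiniteness
import Literature.RingTheory.LocalCohomology.CechBaseChange

/-!
# Transport of the `J`-torsion of Čech `H²` across base change and across linear isomorphisms —
# sub-goals (L1c) of stub (R) `stub_raynaudConnectedness`

Route `SkinnerWilesDefectOne`, crux `ReducibleOrdinaryProModular` (stmt-Langlands-12919), line
`fine-selmer-codimension-two`, registered stub (R) `stub_raynaudConnectedness` (Grothendieck's
connectedness theorem [SGA2 XIII 2.1] in crossing form), sub-goals (L1c).  For the extended Čech
complex `Č(y; M)` of the tree (`Literature.RingTheory.LocalCohomology`: `Z¹ = ker(Č¹ → Č²)`,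
`B¹ = im(Č⁰ → Č¹)`, `H² = Z¹/B¹`, `H2.mk`, `H2.mk_eq_zero_iff`) we prove, sorry-free:

* `Theorems.smul_H2Mk` / `Theorems.smul_H2Mk_eq_zero_iff` — `r • [z] = [r • z]`, and `r` kills the
  class of a cocycle `z` iff `r • z` is a coboundary;
* `Theorems.H2_smul_eq_zero_baseChange` — for an `R`-algebra `B`, a `B`-module `M` and
  `y : Fin s → R` with image `ȳ = algebraMap ∘ y` (tree `yB`): if `J · H²(y; M) = 0` over `R`, then
  `(J B) · H²(ȳ; M) = 0` over `B`.  The base-change isomorphisms `Č^n(y; M) ≅ Č^n(ȳ; M)` (tree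
  `cechObjBaseChange`) commute with the differentials (`dC_cechObjBaseChange`), so a cocycle `z'` of
  `Č¹(ȳ; M)` is the image of a cocycle `z` of `Č¹(y; M)`, and `r z = d w` transports to
  `r z' = d w'`;
* `Theorems.H2_smul_eq_zero_of_linearEquiv` — `J · H²(y; M) = 0` is invariant under `M ≃ₗ[A] N`
  (functoriality of the Čech complex in the module: tree `cechObjMap`, `dC_cechObjMap`,
  `cechObjMap_comp`, `cechObjMap_smul_id`);
* `FineSelmerCodimensionTwo.stub_raynaudConnectedness_auxH2BaseChange` and
  `FineSelmerCodimensionTwo.stub_raynaudConnectedness_auxH2LinearEquiv` — the registered signatures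
  verbatim (universe `0`).

References: A. Grothendieck, SGA 2, Exp. II (the Čech/Koszul computation of local cohomology and its
independence of the base ring), Exp. XIII Thm. 2.1 [Grothendieck1968SGA2]; M. Brodmann, R. Sharp,
*Local cohomology*, CUP 1998, 4.2.1 (independence of base), 5.1.20 [BrodmannSharp1998].
-/

set_option linter.dupNamespace false -- project-wide option (lakefile weak.linter.dupNamespace); `Summit.Langlands.Langlands` is the mandated namespace
set_option autoImplicit false

namespace Summit.Langlands.Langlands.Theorems

open Literature.RingTheory.LocalCohomology

universe u

section SMulClass

variable {R : Type u} [CommRing R] {s : ℕ} {y : Fin s → R} {M : Type u} [AddCommGroup M] [Module R M]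

/-- `r • [z] = [r • z]` in `H² = Z¹/B¹`. [folklore] -/
theorem smul_H2Mk (r : R) (z : CechObj y M 1) (hz : dC 1 z = 0) :
    r • H2.mk z hz = H2.mk (r • z) (by rw [map_smul, hz, smul_zero]) :=
  rfl

/-- `r` kills the class of a cocycle `z` iff `r • z` is a coboundary. [folklore] -/
theorem smul_H2Mk_eq_zero_iff (r : R) (z : CechObj y M 1) (hz : dC 1 z = 0) :
    r • H2.mk z hz = 0 ↔ ∃ w : CechObj y M 0, dC 0 w = r • z := by
  rw [smul_H2Mk]
  exact H2.mk_eq_zero_iff (r • z) _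

/-- Every class of `H²` is the class of a cocycle. [folklore] -/
theorem H2_mk_surjective (c : H2 (y := y) (M := M)) :
    ∃ (z : CechObj y M 1) (hz : dC 1 z = 0), H2.mk z hz = c := by
  obtain ⟨⟨z, hz⟩, rfl⟩ := Submodule.Quotient.mk_surjective _ c
  exact ⟨z, hz, rfl⟩

end SMulClass

/-- **The `J`-torsion of `H²` is preserved by base change.**  For an `R`-algebra `B`, a `B`-module
`M` and `y : Fin s → R` with image `ȳ = algebraMap ∘ y`: if every class of `H²(y; M)` (computed over
`R`) is killed by `J`, then every class of `H²(ȳ; M)` (computed over `B`) is killed by `J B`.  The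
base-change isomorphisms of cochains commute with the Čech differentials. [folklore] -/
theorem H2_smul_eq_zero_baseChange {R : Type u} [CommRing R] (B : Type u) [CommRing B]
    [Algebra R B] {s : ℕ} (y : Fin s → R) (M : Type u) [AddCommGroup M] [Module B M] [Module R M]
    [IsScalarTower R B M] (J : Ideal R)
    (hJ : ∀ c : H2 (y := y) (M := M), ∀ r ∈ J, r • c = 0)
    (c : H2 (y := yB B y) (M := M)) (r : R) (hr : r ∈ J) : algebraMap R B r • c = 0 := by
  obtain ⟨z', hz', rfl⟩ := H2_mk_surjective c
  -- the cocycle `z'` over `B` comes from the cocycle `z := (base change)⁻¹ z'` over `R`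
  have hzz' : cechObjBaseChange B y M 1 ((cechObjBaseChange B y M 1).symm z') = z' :=
    (cechObjBaseChange B y M 1).apply_symm_apply z'
  have hz : dC 1 ((cechObjBaseChange B y M 1).symm z') = 0 := by
    apply (cechObjBaseChange B y M 2).injective
    have h := dC_cechObjBaseChange B y M 1 ((cechObjBaseChange B y M 1).symm z')
    rw [hzz', hz'] at h
    rw [map_zero]
    exact h.symm
  -- `r` kills `[z]`: `r • z = d w`
  obtain ⟨w, hw⟩ := (smul_H2Mk_eq_zero_iff r _ hz).mp (hJ _ r hr)
  -- transport back along the base change: `r • z' = d (base change of w)`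
  rw [smul_H2Mk_eq_zero_iff]
  refine ⟨cechObjBaseChange B y M 0 w, ?_⟩
  have h0 := dC_cechObjBaseChange B y M 0 w
  rw [hw, map_smul, hzz'] at h0
  rw [h0, algebraMap_smul]

/-- **The `J`-torsion of `H²` is invariant under isomorphisms of the module.**  If every class of
`H²(y; M)` is killed by `J` and `e : M ≃ₗ[A] N`, then every class of `H²(y; N)` is killed by `J`
(functoriality of the Čech complex in the module). [folklore] -/
theorem H2_smul_eq_zero_of_linearEquiv {A : Type u} [CommRing A] {s : ℕ} (y : Fin s → A)
    {M N : Type u} [AddCommGroup M] [Module A M] [AddCommGroup N] [Module A N] (e : M ≃ₗ[A] N)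
    (J : Ideal A) (hJ : ∀ c : H2 (y := y) (M := M), ∀ r ∈ J, r • c = 0)
    (c : H2 (y := y) (M := N)) (r : A) (hr : r ∈ J) : r • c = 0 := by
  obtain ⟨z, hz, rfl⟩ := H2_mk_surjective c
  -- the cocycle `z₀ := Č¹(e⁻¹) z` of `Č¹(y; M)`
  have hz₀ : dC 1 (cechObjMap y e.symm.toLinearMap 1 z) = 0 := by
    rw [dC_cechObjMap, hz, map_zero]
  -- `r` kills `[z₀]`: `r • z₀ = d w₀`
  obtain ⟨w₀, hw₀⟩ := (smul_H2Mk_eq_zero_iff r _ hz₀).mp (hJ _ r hr)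
  -- `Č¹(e) (Č¹(e⁻¹) z) = z`
  have hid : cechObjMap y (LinearMap.id : N →ₗ[A] N) 1 = LinearMap.id := by
    have h := cechObjMap_smul_id (y := y) (M := N) 1 1
    rwa [one_smul, one_smul] at h
  have hcomp : cechObjMap y e.toLinearMap 1 (cechObjMap y e.symm.toLinearMap 1 z) = z := by
    have h := LinearMap.congr_fun (cechObjMap_comp (y := y) e.symm.toLinearMap e.toLinearMap 1) z
    rw [LinearMap.comp_apply] at h
    rw [← h, show e.toLinearMap ∘ₗ e.symm.toLinearMap = LinearMap.id from
      LinearMap.ext fun n => e.apply_symm_apply n, hid, LinearMap.id_apply]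
  -- transport: `r • z = d (Č⁰(e) w₀)`
  rw [smul_H2Mk_eq_zero_iff]
  refine ⟨cechObjMap y e.toLinearMap 0 w₀, ?_⟩
  have h0 := dC_cechObjMap e.toLinearMap 0 w₀
  rw [hw₀, map_smul, hcomp] at h0
  exact h0

end Summit.Langlands.Langlands.Theorems

/-! ## The registered sub-goals (verbatim signatures) -/

namespace Summit.Langlands.Langlands.Cruxes.ReducibleOrdinaryProModular.FineSelmerCodimensionTwo

/-- **Registered sub-goal `stub_raynaudConnectedness_auxH2BaseChange` of stub (R)
`stub_raynaudConnectedness`** (L1c): the `J`-torsion property of Čech `H²` passes from the base ring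
`R` to an `R`-algebra `B` (`Theorems.H2_smul_eq_zero_baseChange` at universe `0`). [folklore] -/
theorem stub_raynaudConnectedness_auxH2BaseChange :
    ∀ (R : Type) [CommRing R] (B : Type) [CommRing B] [Algebra R B] (s : ℕ) (y : Fin s → R) (M : Type) [AddCommGroup M] [Module B M] [Module R M] [IsScalarTower R B M] (J : Ideal R), (∀ c : Literature.RingTheory.LocalCohomology.H2 (y := y) (M := M), ∀ r ∈ J, r • c = 0) → ∀ c : Literature.RingTheory.LocalCohomology.H2 (y := Literature.RingTheory.LocalCohomology.yB B y) (M := M), ∀ r ∈ J, algebraMap R B r • c = 0 :=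
  fun _ _ B _ _ _ y M _ _ _ _ J hJ c r hr =>
    Summit.Langlands.Langlands.Theorems.H2_smul_eq_zero_baseChange B y M J hJ c r hr

/-- **Registered sub-goal `stub_raynaudConnectedness_auxH2LinearEquiv` of stub (R)
`stub_raynaudConnectedness`** (L1c): the `J`-torsion property of Čech `H²` is invariant under linear
isomorphisms of the module (`Theorems.H2_smul_eq_zero_of_linearEquiv` at universe `0`). [folklore] -/
theorem stub_raynaudConnectedness_auxH2LinearEquiv :
    ∀ (A : Type) [CommRing A] (s : ℕ) (y : Fin s → A) (M N : Type) [AddCommGroup M] [Module A M] [AddCommGroup N] [Module A N] (e : M ≃ₗ[A] N) (J : Ideal A), (∀ c : Literature.RingTheory.LocalCohomology.H2 (y := y) (M := M), ∀ r ∈ J, r • c = 0) → ∀ c : Literature.RingTheory.LocalCohomology.H2 (y := y) (M := N), ∀ r ∈ J, r • c = 0 :=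
  fun _ _ _ y _ _ _ _ _ _ e J hJ c r hr =>
    Summit.Langlands.Langlands.Theorems.H2_smul_eq_zero_of_linearEquiv y e J hJ c r hr

end Summit.Langlands.Langlands.Cruxes.ReducibleOrdinaryProModular.FineSelmerCodimensionTwo
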